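import Literature.NumberTheory.Sieve.PolymathBoundedGaps
import HarnessLib

/-!
# Stadlmann 2026: `H₁ ≤ 240` — a CLAIMED record for bounded gaps between primes

Trunk: AntSieve / parity.S13 (numeric record of the GPY–Maynard–Tao method).  Source:
J. Stadlmann, *Bounded gaps between primes*, arXiv:2608.31126v1 [math.NT], 31 August 2026
(34 pp. + computational data).  **Status: CLAIMED — an arXiv preprint, unrefereed at the time of typing
(2026-09-01); the result is under adjudication and is recorded here as a NAMED FACT, not proved.**

Printed statement (Theorem 1, p. 1): "The quantity `H₁ = liminf_{n→∞} (p_{n+1} − p_n)` satisfies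
`H₁ ≤ 240`."  Context (p. 1): Polymath 8b proved `H₁ ≤ 246` using only the Bombieri–Vinogradov
theorem (tree: `frequently_nth_prime_succ_le_add_polymath`, decomposed in `PolymathBoundedGaps.lean`);
"the value 246 corresponds to the length of the shortest admissible 50-tuple, while 240 is the length
of the shortest admissible 49-tuple.  The bound `H₁ ≤ 240` is therefore the smallest possible
improvement."  Method (§1.1 and p. 34): the function support given by Bombieri–Vinogradov is combined
with equidistribution estimates of Zhang type for moduli with a large `x^δ`-smooth factor
(variants of Polymath 8a, Algebra Number Theory 8 (2014), and of Stadlmann, Adv. Math. 468 (2025),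
proved in the paper), giving a larger support `T_k(δ, A, B, ε)` in the GPY optimisation problem;
Proposition 1 (p. 5) is the sieve statement "a symmetric square-integrable `F` on `T_k(δ, A, B, ε)` with
ratio `> 1` gives `H₁ ≤ H(k)`", and the proof of Theorem 1 (p. 34) takes `ε = 0.0075`,
`A = (−ε, 0.253)`, `δ = 0.028`, computes "the relevant matrices `M₁` and `M₂` for `k = 49`" and
obtains a vector `c` with `c M₂ cᵀ / c M₁ cᵀ > 1` (symmetric polynomials of degree `≤ 21`;
computer-assisted, NOT verified here).

## Contents

* `frequently_nth_prime_succ_le_add_stadlmann` — the named fact `liminf (p_{n+1} − p_n) ≤ 240`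
  (Theorem 1), in the `liminf`-free rendering of parity.S13 / `frequently_nth_prime_succ_le_add_polymath`.
  NOT proved here.
* `narrowTuple49` — an admissible 49-tuple of diameter `240`, witnessing `H(49) ≤ 240` (the value
  quoted on p. 1; the tuple is the one listed in the prime `k`-tuples tables of the Polymath 8 project,
  `math.mit.edu/~primegaps/tuples/admissible_49_240.txt`, after Engelsma's exhaustive computations
  cited in Polymath 8b §3 Thm 3.3).  PROVED admissible by a kernel computation
  (`isAdmissibleTuple_narrowTuple49`), exactly as `narrowTuple50` in `PolymathBoundedGaps.lean`.
* `frequently_nth_prime_succ_le_add_stadlmann_of_weakDHL` — PROVED: `DHL[49, 2]` (the Polymath 8b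
  Claim 3.1 reading of a `k = 49` sieve computation; Polymath 8b p. 8 "`DHL[k, m+1]` implies
  `H_m ≤ H(k)`") implies the claimed record, via `narrowTuple49` and
  `WeakDicksonHardyLittlewood.frequently_nth_prime_add_le`.  This isolates what a verification of the
  preprint has to deliver in the tree's language.
* `frequently_nth_prime_succ_le_add_polymath_of_stadlmann` — PROVED (monotonicity `240 ≤ 246`): the
  claimed record implies the tree's Polymath 8b fact.

## Design notes

* Nothing in this file asserts the preprint's correctness: the record enters only as the `Prop`
  `frequently_nth_prime_succ_le_add_stadlmann`, to be used as a hypothesis `(h : …)`.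
* The parity-relevant reading is unchanged by the record: the outputs of the method are disjunctions
  over the shifts of a `k`-tuple (`k = 49` instead of `50`), cf. Polymath 8b Thm 1.4 and §8 (the
  `H₁ ≤ 6` limit on GEH); see `Literature/Barriers/Parity/MaynardFunctionalCeiling.lean`.

## References

* J. Stadlmann, *Bounded gaps between primes*, arXiv:2608.31126v1 (2026). [Stadlmann2026BoundedGaps]
* D. H. J. Polymath, *Variants of the Selberg sieve, and bounded intervals containing many primes*,
  Res. Math. Sci. 1 (2014), Art. 12; arXiv:1407.4897. [Polymath8b2014]
* J. Stadlmann, *On primes in arithmetic progressions and bounded gaps between many primes*,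
  Adv. Math. 468 (2025), 110190. [Stadlmann2023BoundedGapsManyPrimes]
-/

open Filter Finset

namespace Literature.NumberTheory.Sieve

/-! ### The named fact: Theorem 1 -/

/-- **Stadlmann 2026, Theorem 1** (CLAIMED; arXiv:2608.31126v1, p. 1; unrefereed, under
adjudication): `liminf_{n→∞} (p_{n+1} − p_n) ≤ 240`, rendered `liminf`-free as "`p_{n+1} ≤ p_n + 240`
for infinitely many `n`" exactly as parity.S13's `frequently_nth_prime_succ_le_add_polymath` (`246`).
Named fact, NOT proved here (the proof is a computer-assisted `k = 49` eigenvalue computation over the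
enlarged support `T_k(δ, A, B, ε)`, p. 34). [cite: Stadlmann2026BoundedGaps, Theorem 1] -/
def frequently_nth_prime_succ_le_add_stadlmann : Prop :=
  ∃ᶠ n in atTop, Nat.nth Nat.Prime (n + 1) ≤ Nat.nth Nat.Prime n + 240

/-! ### A narrow admissible 49-tuple: `H(49) ≤ 240` -/

/-- An admissible 49-tuple of diameter `240`, witnessing `H(49) ≤ 240` — the value quoted by
Stadlmann (p. 1: "240 is the length of the shortest admissible 49-tuple"); the tuple is the entry
`admissible_49_240` of the Polymath 8 prime `k`-tuples tables (Engelsma's computations, cited in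
Polymath 8b, Theorem 3.3 and §3). [cite: Stadlmann2026BoundedGaps, p. 1][cite: Polymath8b2014, Theorem 3.3] -/
def narrowTuple49 : Finset ℤ :=
  {0, 4, 10, 12, 18, 22, 28, 30, 52, 54, 58, 60, 64, 70, 72, 78, 82, 84, 88, 94, 100, 102, 108, 114,
    120, 124, 130, 138, 142, 148, 154, 162, 168, 172, 180, 184, 190, 192, 198, 204, 208, 210, 214,
    220, 228, 232, 234, 238, 240}

/-- `narrowTuple49` has 49 elements. [cite: Stadlmann2026BoundedGaps, p. 1] -/
theorem card_narrowTuple49 : narrowTuple49.card = 49 := by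
  decide +kernel

/-- `narrowTuple49 ⊆ [0, 240]`, so its diameter is `≤ 240`. [cite: Stadlmann2026BoundedGaps, p. 1] -/
theorem narrowTuple49_mem_Icc : ∀ h ∈ narrowTuple49, (0 : ℤ) ≤ h ∧ h ≤ 240 := by
  decide +kernel

/-- For every `2 ≤ p ≤ 49` the tuple `narrowTuple49` misses some residue class `r (p)`; a kernel
computation (admissibility testing modulo the primes `p ≤ k`, Polymath 8b §10.2.1). [cite: Polymath8b2014, §10.2.1] -/
theorem narrowTuple49_exists_forall_not_dvd :
    ∀ p ∈ Finset.Icc 2 49, ∃ r ∈ Finset.range p, ∀ h ∈ narrowTuple49, ¬((p : ℤ) ∣ h - r) := by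
  decide +kernel

/-- `narrowTuple49` is admissible, hence `H(49) ≤ 240`.  Only primes `p ≤ 49` need checking
(`isAdmissibleTuple_iff_of_le_card`). [cite: Stadlmann2026BoundedGaps, p. 1][cite: Polymath8b2014, Theorem 3.3] -/
theorem isAdmissibleTuple_narrowTuple49 : IsAdmissibleTuple narrowTuple49 := by
  rw [isAdmissibleTuple_iff_of_le_card, card_narrowTuple49]
  intro p hp hle
  obtain ⟨r, -, hr⟩ := narrowTuple49_exists_forall_not_dvd p (Finset.mem_Icc.2 ⟨hp.two_le, hle⟩)
  exact tupleResidueCount_lt_of_forall_not_dvd hp.pos hr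

/-! ### `DHL[49, 2]` suffices; the record implies the Polymath 8b fact -/

/-- **`DHL[49, 2]` implies `H₁ ≤ 240`** (Polymath 8b, p. 8: "`DHL[k, m+1]` implies `H_m ≤ H(k)`",
with `H(49) ≤ 240` from `narrowTuple49`): the Polymath-language content that a verification of
Stadlmann's `k = 49` computation (Proposition 1 and p. 34) has to deliver. PROVED.
[cite: Stadlmann2026BoundedGaps, Proposition 1 and proof of Theorem 1 (p. 34)][cite: Polymath8b2014, §3, remark after Claim 3.1] -/
theorem frequently_nth_prime_succ_le_add_stadlmann_of_weakDHL
    (h : WeakDicksonHardyLittlewood 49 2) : frequently_nth_prime_succ_le_add_stadlmann :=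
  h.frequently_nth_prime_add_le (m := 1) isAdmissibleTuple_narrowTuple49 card_narrowTuple49
    (d := 240) fun a ha b hb => by
      have h1 := narrowTuple49_mem_Icc a ha
      have h2 := narrowTuple49_mem_Icc b hb
      push_cast
      omega

/-- The claimed record `H₁ ≤ 240` implies the tree's Polymath 8b fact `H₁ ≤ 246`
(`frequently_nth_prime_succ_le_add_polymath`, parity.S13), by `240 ≤ 246`. PROVED.
[cite: Stadlmann2026BoundedGaps, Theorem 1][cite: Polymath8b2014, Theorem 1.4(i)] -/
theorem frequently_nth_prime_succ_le_add_polymath_of_stadlmann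
    (h : frequently_nth_prime_succ_le_add_stadlmann) : Sieve.frequently_nth_prime_succ_le_add_polymath :=
  h.mono fun n hn => le_trans hn (by omega)

end Literature.NumberTheory.Sieve
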